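import Mathlib
import Literature.NumberTheory.Transcendental.KZCalculusProofs
import Literature.NumberTheory.Transcendental.KZLogCalculusProofs
import Literature.NumberTheory.Transcendental.KZSemialgebraicComplex

/-!
# Stub `stub_logRectInvert` — crux `OffTetraSectorKernel`, line `odd-hyperbolic-ladder`

Stub `stub_logRectInvert` of the crux `OffTetraSectorKernel` (stmt-KontsevichZagierPeriods-10557,
route HyperbolicBloch). In Rogers' normalisation `R(a) = 2[T a] + [N(1/a, 1/(1−a))]` of the
dilogarithm ladder (`N(a,b) = [(1,a) × (1,b), 1/(u w)]`, value `log a · log b`), Euler's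
rectangle `Px = [{x<u<1, 0<v<x}, 1/(u(1−v))]` (value `log x · log(1−x)`) has to be identified
with `N(1/x, 1/(1−x))` for real algebraic `0 < x < 1`. This file is that ONE change-of-variables
move (KZ rule (2), `KZ.changeOfVariablesRel ⊆ KZ.relations`) along the product of the two
one-variable Möbius maps `Φ(u,v) = (1/u, 1/(1−v))`: `Φ` maps `{x<u<1, 0<v<x}` bijectively onto
`(1, 1/x) × (1, 1/(1−x))` (`u ∈ (x,1) ↦ 1/u ∈ (1,1/x)`, `v ∈ (0,x) ↦ 1/(1−v) ∈ (1,1/(1−x))`),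
its derivative is `diag(−1/u², 1/(1−v)²)` with `|det| = 1/(u²(1−v)²)`, and
`[1/(u' w')](Φ(u,v)) · |det| = u(1−v)/(u²(1−v)²) = 1/(u(1−v))`.

References: M. Kontsevich, D. Zagier, *Periods* (2001), §1.2 rule (2); J. Bochnak, M. Coste,
M.-F. Roy, *Real Algebraic Geometry* (1998), §2.2. No definitions are introduced.
-/

noncomputable section

open Set MeasureTheory MvPolynomial
open Literature.NumberTheory.Transcendental Literature.ModelTheory.ExponentialFields

namespace Summit.KontsevichZagierPeriods.HyperbolicBloch.OffTetraSectorKernel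

/-! ### The inversion map `Φ(u,v) = (1/u, 1/(1−v))` of the plane -/

/-- First coordinate of the inversion map: `Φ p 0 = 1 / p 0`. [folklore] -/
theorem logRectInvert_map_apply_zero (Φ : (Fin 2 → ℝ) → (Fin 2 → ℝ))
    (hΦ : ∀ p, Φ p = ![1 / p 0, 1 / (1 - p 1)]) (p : Fin 2 → ℝ) : Φ p 0 = 1 / p 0 := by
  rw [hΦ]
  rfl

/-- Second coordinate of the inversion map: `Φ p 1 = 1 / (1 − p 1)`. [folklore] -/
theorem logRectInvert_map_apply_one (Φ : (Fin 2 → ℝ) → (Fin 2 → ℝ))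
    (hΦ : ∀ p, Φ p = ![1 / p 0, 1 / (1 - p 1)]) (p : Fin 2 → ℝ) : Φ p 1 = 1 / (1 - p 1) := by
  rw [hΦ]
  rfl

/-- The inversion map is injective on `{0 < u, v < 1}` (`u ↦ 1/u` and `v ↦ 1/(1−v)` are
injective off their poles). [folklore] -/
theorem logRectInvert_map_injOn (Φ : (Fin 2 → ℝ) → (Fin 2 → ℝ))
    (hΦ : ∀ p, Φ p = ![1 / p 0, 1 / (1 - p 1)]) :
    InjOn Φ {p : Fin 2 → ℝ | 0 < p 0 ∧ p 1 < 1} := by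
  intro a _ b _ h
  have e0 : 1 / a 0 = 1 / b 0 := by
    rw [← logRectInvert_map_apply_zero Φ hΦ a, ← logRectInvert_map_apply_zero Φ hΦ b, h]
  have e1 : 1 / (1 - a 1) = 1 / (1 - b 1) := by
    rw [← logRectInvert_map_apply_one Φ hΦ a, ← logRectInvert_map_apply_one Φ hΦ b, h]
  rw [one_div, one_div, inv_inj] at e0 e1
  funext i
  fin_cases i
  exacts [e0, sub_right_inj.mp e1]

/-- The inversion map is a `ℚ`-semialgebraic map on every `ℚ`-semialgebraic
`σ ⊆ {0 < u, v < 1}`: its coordinates are quotients of `ℚ`-polynomials with non-vanishing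
denominators. [cite: BochnakCosteRoy1998, §2.2] -/
theorem logRectInvert_map_isSemialgebraicMapOn (Φ : (Fin 2 → ℝ) → (Fin 2 → ℝ))
    (hΦ : ∀ p, Φ p = ![1 / p 0, 1 / (1 - p 1)]) {σ : Set (Fin 2 → ℝ)}
    (hσ : IsSemialgebraic ℚ σ) (hsub : σ ⊆ {p | 0 < p 0 ∧ p 1 < 1}) :
    IsSemialgebraicMapOn ℚ σ Φ := by
  refine IsSemialgebraicMapOn.of_forall hσ fun j => ?_
  fin_cases j
  · have hq : ∀ p ∈ σ, aeval p (X 0 : MvPolynomial (Fin 2) ℚ) ≠ 0 := fun p hp => by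
      simpa only [MvPolynomial.aeval_X] using (hsub hp).1.ne'
    exact (isSemialgebraicFunOn_aeval_div_aeval hσ 1 (X 0) hq).congr fun p _ => by
      simp [logRectInvert_map_apply_zero Φ hΦ p]
  · have hq : ∀ p ∈ σ, aeval p (1 - X 1 : MvPolynomial (Fin 2) ℚ) ≠ 0 := fun p hp => by
      simpa only [map_sub, map_one, MvPolynomial.aeval_X] using (sub_pos.2 (hsub hp).2).ne'
    exact (isSemialgebraicFunOn_aeval_div_aeval hσ 1 (1 - X 1) hq).congr fun p _ => by
      simp [logRectInvert_map_apply_one Φ hΦ p]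

/-- **The image of Euler's rectangle under the inversion map**: for `0 < x < 1`,
`Φ '' {x<u<1, 0<v<x} = (1, 1/x) × (1, 1/(1−x))`; the preimage of `(a, b)` is `(1/a, 1 − 1/b)`.
[folklore] -/
theorem logRectInvert_map_image (Φ : (Fin 2 → ℝ) → (Fin 2 → ℝ))
    (hΦ : ∀ p, Φ p = ![1 / p 0, 1 / (1 - p 1)]) {x : ℝ} (hx0 : 0 < x) (hx1 : x < 1) :
    Φ '' {w : Fin 2 → ℝ | x < w 0 ∧ w 0 < 1 ∧ 0 < w 1 ∧ w 1 < x} =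
      {w : Fin 2 → ℝ | 1 < w 0 ∧ w 0 < 1 / x ∧ 1 < w 1 ∧ w 1 < 1 / (1 - x)} := by
  ext q
  constructor
  · rintro ⟨p, ⟨h1, h2, h3, h4⟩, rfl⟩
    simp only [mem_setOf_eq, logRectInvert_map_apply_zero Φ hΦ p,
      logRectInvert_map_apply_one Φ hΦ p]
    have hp0 : 0 < p 0 := hx0.trans h1
    have hp1 : 0 < 1 - p 1 := by linarith
    have hp1' : 1 - p 1 < 1 := by linarith
    have hxp : 1 - x < 1 - p 1 := by linarith
    exact ⟨one_lt_one_div hp0 h2, one_div_lt_one_div_of_lt hx0 h1, one_lt_one_div hp1 hp1',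
      one_div_lt_one_div_of_lt (sub_pos.2 hx1) hxp⟩
  · rintro ⟨h1, h2, h3, h4⟩
    have hq0 : 0 < q 0 := one_pos.trans h1
    have hq1 : 0 < q 1 := one_pos.trans h3
    have h2' : q 0 * x < 1 := (lt_div_iff₀ hx0).1 h2
    have h4' : q 1 * (1 - x) < 1 := (lt_div_iff₀ (sub_pos.2 hx1)).1 h4
    have h1' : 1 / q 0 < 1 := (div_lt_one hq0).2 h1
    have h3' : 1 / q 1 < 1 := (div_lt_one hq1).2 h3
    have hxq0 : x < 1 / q 0 := by
      rw [lt_div_iff₀ hq0]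
      linarith
    have hxq1 : 1 - x < 1 / q 1 := by
      rw [lt_div_iff₀ hq1]
      linarith
    refine ⟨![1 / q 0, 1 - 1 / q 1], ?_, ?_⟩
    · simp only [mem_setOf_eq, Matrix.cons_val_zero, Matrix.cons_val_one]
      exact ⟨hxq0, h1', by linarith, by linarith⟩
    · rw [hΦ]
      funext i
      fin_cases i
      · simp
      · simp

/-- **The derivative of the inversion map and its determinant.** At every point a linear map `L`
of matrix `diag(−1/u², 1/(1−v)²)` (Lean's `1/0 = 0` convention at the poles), which is the
Fréchet derivative of `Φ` wherever `u ≠ 0`, `v ≠ 1`, and `det L = −(1/u² · 1/(1−v)²)`.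
[folklore] -/
theorem logRectInvert_map_hasFDerivAt_det (Φ : (Fin 2 → ℝ) → (Fin 2 → ℝ))
    (hΦ : ∀ p, Φ p = ![1 / p 0, 1 / (1 - p 1)]) (p : Fin 2 → ℝ) :
    ∃ L : (Fin 2 → ℝ) →L[ℝ] (Fin 2 → ℝ), (p 0 ≠ 0 → 1 - p 1 ≠ 0 → HasFDerivAt Φ L p) ∧
      L.det = -(1 / p 0 ^ 2 * (1 / (1 - p 1) ^ 2)) := by
  have hd0 : ∀ t : ℝ, t ≠ 0 → HasDerivAt (fun s : ℝ => 1 / s) (-1 / t ^ 2) t := fun t ht => by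
    refine ((hasDerivAt_const t (1 : ℝ)).fun_div (hasDerivAt_id' t) ht).congr_deriv ?_
    ring
  have hd1 : ∀ t : ℝ, 1 - t ≠ 0 →
      HasDerivAt (fun s : ℝ => 1 / (1 - s)) (1 / (1 - t) ^ 2) t := fun t ht => by
    refine ((hasDerivAt_const t (1 : ℝ)).fun_div ((hasDerivAt_id' t).const_sub 1)
      ht).congr_deriv ?_
    ring
  set M : Matrix (Fin 2) (Fin 2) ℝ := !![-1 / p 0 ^ 2, 0; 0, 1 / (1 - p 1) ^ 2] with hM
  refine ⟨LinearMap.toContinuousLinearMap (Matrix.toLin' M), fun h0 h1 => ?_, ?_⟩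
  · -- derivative, componentwise
    refine hasFDerivAt_pi'' fun i => ?_
    fin_cases i
    · have hf : (fun x => Φ x 0) = (fun s : ℝ => 1 / s) ∘ fun x : Fin 2 → ℝ => x 0 := by
        funext x
        exact logRectInvert_map_apply_zero Φ hΦ x
      simp only [Fin.zero_eta]
      rw [hf]
      refine ((hd0 (p 0) h0).comp_hasFDerivAt p
        (hasFDerivAt_apply (𝕜 := ℝ) 0 p)).congr_fderiv ?_
      ext v
      simp [hM, Matrix.toLin'_apply, dotProduct, Fin.sum_univ_two]
    · have hf : (fun x => Φ x 1) = (fun s : ℝ => 1 / (1 - s)) ∘ fun x : Fin 2 → ℝ => x 1 := by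
        funext x
        exact logRectInvert_map_apply_one Φ hΦ x
      simp only [Fin.mk_one]
      rw [hf]
      refine ((hd1 (p 1) h1).comp_hasFDerivAt p
        (hasFDerivAt_apply (𝕜 := ℝ) 1 p)).congr_fderiv ?_
      ext v
      simp [hM, Matrix.toLin'_apply, dotProduct, Fin.sum_univ_two]
  · -- determinant
    rw [LinearMap.det_toContinuousLinearMap, LinearMap.det_toLin', hM, Matrix.det_fin_two_of]
    ring

/-- The Jacobian identity behind the move (`u ≠ 0`, `1 − v ≠ 0`):
`1/(u(1−v)) = [1/(u' w')](1/u, 1/(1−v)) · (1/u² · 1/(1−v)²)`. [folklore] -/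
theorem logRectInvert_jacobian_identity {u v : ℝ} (hu : u ≠ 0) (hv : 1 - v ≠ 0) :
    1 / (u * (1 - v)) = 1 / (1 / u * (1 / (1 - v))) * (1 / u ^ 2 * (1 / (1 - v) ^ 2)) := by
  field_simp

/-! ### The move -/

/-- **Stub `stub_logRectInvert`** (rule (2), ONE move): for real algebraic `0 < x < 1`, Euler's
rectangle `P = [{x<u<1, 0<v<x}, 1/(u(1−v))]` and the log rectangle
`N = [(1,1/x) × (1,1/(1−x)), 1/(u w)]` satisfy `[P] − [N] ∈ KZ.relations`: the inversion map
`Φ(u,v) = (1/u, 1/(1−v))` is `ℚ`-semialgebraic and injective on `P.domain`, maps it onto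
`N.domain`, has derivative `diag(−1/u², 1/(1−v)²)` there, and
`N.integrand (Φ(u,v)) · |det Φ'| = u(1−v) · 1/(u²(1−v)²) = 1/(u(1−v)) = P.integrand (u,v)`, so
`[P] − [N]` is a single element of `KZ.changeOfVariablesRel ⊆ KZ.relations`.
[cite: KontsevichZagier2001, §1.2 rule (2)] -/
theorem stub_logRectInvert :
    ∀ (x : ℝ), IsAlgebraic ℚ x → 0 < x → x < 1 →
    ∀ (P N : KZ.IntegralRep 2),
      P.domain = {w | x < w 0 ∧ w 0 < 1 ∧ 0 < w 1 ∧ w 1 < x} →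
      Set.EqOn P.integrand (fun w => 1 / (w 0 * (1 - w 1))) P.domain →
      N.domain = {w | 1 < w 0 ∧ w 0 < 1 / x ∧ 1 < w 1 ∧ w 1 < 1 / (1 - x)} →
      Set.EqOn N.integrand (fun w => 1 / (w 0 * w 1)) N.domain →
      KZ.of P - KZ.of N ∈ KZ.relations := by
  intro x _ hx0 hx1 P N hPd hPi hNd hNi
  -- the inversion map
  set Φ : (Fin 2 → ℝ) → (Fin 2 → ℝ) := fun p => ![1 / p 0, 1 / (1 - p 1)]
  have hΦ : ∀ p, Φ p = ![1 / p 0, 1 / (1 - p 1)] := fun _ => rfl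
  -- on Euler's rectangle `0 < x < u` and `v < x < 1`
  have hT : ∀ w ∈ P.domain, 0 < w 0 ∧ 0 < 1 - w 1 := fun w hw => by
    rw [hPd] at hw
    obtain ⟨g1, -, -, g4⟩ := hw
    exact ⟨hx0.trans g1, by linarith⟩
  have hsub : P.domain ⊆ {p | 0 < p 0 ∧ p 1 < 1} := fun w hw =>
    ⟨(hT w hw).1, sub_pos.1 (hT w hw).2⟩
  -- the data of the move
  have hΦsa : IsSemialgebraicMapOn ℚ P.domain Φ :=
    logRectInvert_map_isSemialgebraicMapOn Φ hΦ P.isSemialgebraic_domain hsub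
  have hinj : InjOn Φ P.domain := (logRectInvert_map_injOn Φ hΦ).mono hsub
  choose Φ' hΦ'd hΦ'det using logRectInvert_map_hasFDerivAt_det Φ hΦ
  have hderiv : ∀ w ∈ P.domain, HasFDerivWithinAt Φ (Φ' w) P.domain w := fun w hw =>
    (hΦ'd w (hT w hw).1.ne' (hT w hw).2.ne').hasFDerivWithinAt
  have himage : N.domain = Φ '' P.domain := by
    rw [hPd, hNd]
    exact (logRectInvert_map_image Φ hΦ hx0 hx1).symm
  -- rule (2): `[P] − [N]` is one change-of-variables move
  refine KZ.changeOfVariablesRel_subset_relations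
    ⟨2, P, N, Φ, Φ', hΦsa, hderiv, hinj, himage, fun w hw => ?_, rfl⟩
  have hwN : Φ w ∈ N.domain := himage ▸ mem_image_of_mem Φ hw
  obtain ⟨h0, h1⟩ := hT w hw
  have hpos : 0 < 1 / w 0 ^ 2 * (1 / (1 - w 1) ^ 2) :=
    mul_pos (one_div_pos.2 (pow_pos h0 2)) (one_div_pos.2 (pow_pos h1 2))
  rw [hPi hw, hNi hwN, hΦ'det w, abs_neg, abs_of_pos hpos]
  show 1 / (w 0 * (1 - w 1)) = 1 / (Φ w 0 * Φ w 1) * (1 / w 0 ^ 2 * (1 / (1 - w 1) ^ 2))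
  rw [logRectInvert_map_apply_zero Φ hΦ w, logRectInvert_map_apply_one Φ hΦ w]
  exact logRectInvert_jacobian_identity h0.ne' h1.ne'

end Summit.KontsevichZagierPeriods.HyperbolicBloch.OffTetraSectorKernel

end
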